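import Summits.NavierStokesRegularity.NavierStokesRegularity.Theorems.ExtremiserTransiencePerFlowNearEfficientRecurrence
import Summits.NavierStokesRegularity.NavierStokesRegularity.Theorems.EfficiencyFloorEnstrophyBudget
import HarnessLib

/-!
# Route `ExtremiserTransience`, LINE g4-α «per-flow-tangent» (ns-idea-5 g4): EFFICIENCY FORCES PALINSTROPHY —
# at the near-efficient late times of a flow the product enstrophy × palinstrophy is bounded BELOW

`--supports stmt-NavierStokesRegularity-26568` (`TangentExtremalExtraction`; skeleton v2 stub `stub_scaleLock`).

The registered stub `stub_scaleLock` of the per-flow tangent line asks, when the per-flow conclusion of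
`NearExtremalTransiencePerFlow` (stmt-26567) FAILS, for late times that are (i) near-efficient in the sharp
vortex-stretching inequality and (ii) SCALE-LOCKED (`c₁ν(T−t)·P ≤ Z ≤ c₂ν(T−t)·P`, `Z = ‖ω‖₂²`, `P = ‖∇ω‖₂²`).
Part (i) is the landed `nearEfficient_recurrence_of_not_perFlow`. This file proves the first STRUCTURAL
consequence of efficiency towards (ii):

* `zp_lower_of_efficient` — STATIC: for a `C³` divergence-free field with `v, Dv, D²v ∈ L²`, `|v| ≤ M`, if
  `m·M·‖ω‖₂·‖∇ω‖₂ < |∫⟪ω, ∇v ω⟫|` with `m ≥ 0` then `(m·M)⁴ ≤ c_L⁴ · ‖ω‖₂² · ‖∇ω‖₂²`, where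
  `c_L = K³ + 1` is the constant of the tree's sharp-exponent envelope `|∫⟪ω,∇v ω⟫| ≤ c_L Z^(3/4) P^(3/4)`
  (`EnstrophyBudget.abs_stretchI_le_rpow`; `K` = Mathlib's Sobolev constant of `H¹(ℝ³) ⊂ L⁶`). In words:
  an `m`-efficient field of amplitude `M` has `Z·P ≥ (mM/c_L)⁴` — efficiency at large amplitude FORCES
  palinstrophy. (Envelope divided by the efficiency inequality; elementary.)
* `zp_lower_at_nearEfficient_times` — ALONG THE FLOW: if the per-flow conclusion fails for a classical
  Leray–Hopf rapidly-decaying-datum solution on `[0,T)`, then for every `0 ≤ m < κ⋆` and every `t₁ < T` the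
  set of `t ∈ [t₁, T)` carrying a bound `M ≥ |u(t)|` with `m·M·√Z·√P < |J|` AND `(mM)⁴ ≤ c_L⁴·Z(t)·P(t)` has
  positive measure (slice regularity from `EnstrophyBudget.isLocalSolution` / `sobolev_slice`, Tao 2013 Cor. 11.1
  in the tree).

WHERE THIS SITS IN THE LOCK. With the lock ratio `ρ(t) := ν(T−t)P/Z`: at an `m`-efficient time
`ρ ≥ ν(T−t)(mM)⁴/(c_L⁴ Z²)`, so the LOWER lock `ρ ≥ 1/c₂` follows at those times exactly when the enstrophy is
at most at LERAY'S MINIMAL RATE, `Z(t) ≤ A·M²·√(ν(T−t))` (`≍ ν^(3/2)(T−t)^(−1/2)` at the Type-I rate) — a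
vorticity-CONCENTRATION statement (parabolic-scale concentration at finitely many points gives it), which is
the genuinely open content of `stub_scaleLock`; the UPPER lock at efficient times follows from a gradient
Type-I bound `|∇u| ≤ C₁/(T−t)` and Leray's lower rate `‖u(t)‖_∞ ≥ c₀√(ν/(T−t))` (`mM√Z√P < |J| ≤ ‖∇u‖_∞ Z`).
Neither of those is proved here.

HONEST FRAMING: elementary consequences of landed inequalities; no depletion, no lock, no statement about
Navier–Stokes regularity or blow-up is proved; `TangentExtremalExtraction` (26568) and
`NearExtremalTransiencePerFlow` (26567) stay open. References: Robinson–Rodrigo–Sadowski 2016 (6.7);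
Lu–Doering, Indiana Univ. Math. J. 57 (2008); Leray 1934 §19. [folklore]
-/

noncomputable section
open Set Filter Topology MeasureTheory
open scoped InnerProductSpace RealInnerProductSpace ENNReal NNReal ContDiff
open Literature.Analysis.FluidPDE

namespace Summit.NavierStokesRegularity.NavierStokesRegularity.Theorems.DepletionLadder.PerFlow
set_option linter.dupNamespace false
set_option linter.style.longLine false

open Literature.Claims.NS.LucardoOlivaes2026 (stretchI)
open Summit.NavierStokesRegularity.NavierStokesRegularity.Theorems.EnstrophyBudget
  (abs_stretchI_le_rpow isLocalSolution sobolev_slice)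

/-- **Efficiency forces palinstrophy (static).** For a `C³` divergence-free `v` with `v, Dv, D²v ∈ L²` and
`|v| ≤ M`: if `m·M·‖curl v‖₂·‖∇curl v‖₂ < |∫⟪curl v, Dv curl v⟫|` with `0 ≤ m`, then
`(m·M)⁴ ≤ (K³+1)⁴ · ∫|curl v|² · ∫|∇curl v|²_F`. [folklore] -/
theorem zp_lower_of_efficient {v : EuclideanSpace ℝ (Fin 3) → EuclideanSpace ℝ (Fin 3)}
    (hv : ContDiff ℝ 3 v) (hdiv : VectorCalculus.IsDivFree v)
    (h0 : ∫⁻ x, ‖v x‖ₑ ^ 2 < ⊤) (h1 : ∫⁻ x, ‖iteratedFDeriv ℝ 1 v x‖ₑ ^ 2 < ⊤)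
    (h2 : ∫⁻ x, ‖iteratedFDeriv ℝ 2 v x‖ₑ ^ 2 < ⊤) {m M : ℝ} (hm : 0 ≤ m) (hM : ∀ x, ‖v x‖ ≤ M)
    (heff : m * M * Real.sqrt (∫ x, ‖curl v x‖ ^ 2) * Real.sqrt (∫ x, frobeniusNormSq (fderiv ℝ (curl v) x)) <
      |∫ x, ⟪curl v x, fderiv ℝ v x (curl v x)⟫_ℝ|) :
    (m * M) ^ 4 ≤ ((SNormLESNormFDerivOfEqConst (EuclideanSpace ℝ (Fin 3)) (volume : Measure (EuclideanSpace ℝ (Fin 3))) 2 : ℝ) ^ 3 + 1) ^ 4 * (∫ x, ‖curl v x‖ ^ 2) * (∫ x, frobeniusNormSq (fderiv ℝ (curl v) x)) := by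
  set c : ℝ := ((SNormLESNormFDerivOfEqConst (EuclideanSpace ℝ (Fin 3)) (volume : Measure (EuclideanSpace ℝ (Fin 3))) 2 : ℝ) ^ 3 + 1) with hc
  set Z : ℝ := ∫ x, ‖curl v x‖ ^ 2 with hZ
  set P : ℝ := ∫ x, frobeniusNormSq (fderiv ℝ (curl v) x) with hP
  have hM0 : 0 ≤ M := (norm_nonneg _).trans (hM 0)
  have hZ0 : 0 ≤ Z := integral_nonneg fun x => by positivity
  have hP0 : 0 ≤ P := integral_nonneg fun x => frobeniusNormSq_nonneg _
  have hc0 : 0 ≤ c := by rw [hc]; positivity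
  have henv : |∫ x, ⟪curl v x, fderiv ℝ v x (curl v x)⟫_ℝ| ≤ c * Z ^ (3 / 4 : ℝ) * P ^ (3 / 4 : ℝ) := by
    have h := abs_stretchI_le_rpow hv hdiv h0 h1 h2
    simpa only [stretchI] using h
  have hlt : m * M * Real.sqrt Z * Real.sqrt P < c * Z ^ (3 / 4 : ℝ) * P ^ (3 / 4 : ℝ) :=
    heff.trans_le henv
  have hL0 : 0 ≤ m * M * Real.sqrt Z * Real.sqrt P := by positivity
  have hpos : 0 < c * Z ^ (3 / 4 : ℝ) * P ^ (3 / 4 : ℝ) := hL0.trans_lt hlt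
  have hZpos : 0 < Z := by
    rcases hZ0.lt_or_eq with h | h
    · exact h
    · exfalso
      rw [← h, Real.zero_rpow (by norm_num)] at hpos
      simp at hpos
  have hPpos : 0 < P := by
    rcases hP0.lt_or_eq with h | h
    · exact h
    · exfalso
      rw [← h, Real.zero_rpow (by norm_num)] at hpos
      simp at hpos
  have h4 : (m * M * Real.sqrt Z * Real.sqrt P) ^ 4 ≤ (c * Z ^ (3 / 4 : ℝ) * P ^ (3 / 4 : ℝ)) ^ 4 :=
    pow_le_pow_left₀ hL0 hlt.le 4
  have hsZ : Real.sqrt Z ^ 4 = Z ^ 2 := by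
    rw [show (4 : ℕ) = 2 * 2 from rfl, pow_mul, Real.sq_sqrt hZ0]
  have hsP : Real.sqrt P ^ 4 = P ^ 2 := by
    rw [show (4 : ℕ) = 2 * 2 from rfl, pow_mul, Real.sq_sqrt hP0]
  have hZ3 : (Z ^ (3 / 4 : ℝ)) ^ 4 = Z ^ 2 * Z := by
    rw [← Real.rpow_natCast _ 4, ← Real.rpow_mul hZ0,
      show (3 / 4 : ℝ) * ((4 : ℕ) : ℝ) = ((3 : ℕ) : ℝ) by norm_num, Real.rpow_natCast]
    ring
  have hP3 : (P ^ (3 / 4 : ℝ)) ^ 4 = P ^ 2 * P := by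
    rw [← Real.rpow_natCast _ 4, ← Real.rpow_mul hP0,
      show (3 / 4 : ℝ) * ((4 : ℕ) : ℝ) = ((3 : ℕ) : ℝ) by norm_num, Real.rpow_natCast]
    ring
  have hkey : (m * M) ^ 4 * (Z ^ 2 * P ^ 2) ≤ c ^ 4 * Z * P * (Z ^ 2 * P ^ 2) := by
    calc (m * M) ^ 4 * (Z ^ 2 * P ^ 2) = (m * M * Real.sqrt Z * Real.sqrt P) ^ 4 := by
          simp only [mul_pow, hsZ, hsP]; ring
      _ ≤ (c * Z ^ (3 / 4 : ℝ) * P ^ (3 / 4 : ℝ)) ^ 4 := h4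
      _ = c ^ 4 * Z * P * (Z ^ 2 * P ^ 2) := by simp only [mul_pow, hZ3, hP3]; ring
  exact le_of_mul_le_mul_right hkey (by positivity)

/-- **Along the flow: `Z·P ≥ (mM/c_L)⁴` on a positive-measure set of late times** whenever the per-flow
conclusion of `NearExtremalTransiencePerFlow` fails (`0 ≤ m < κ⋆`, any onset `t₁ < T`): the near-efficient
times of `nearEfficient_recurrence_of_not_perFlow` carry the palinstrophy floor of `zp_lower_of_efficient`.
[folklore] -/
theorem zp_lower_at_nearEfficient_times {ν T : ℝ} (hν : 0 < ν) (hT : 0 < T)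
    {u : ℝ → EuclideanSpace ℝ (Fin 3) → EuclideanSpace ℝ (Fin 3)} {p : ℝ → EuclideanSpace ℝ (Fin 3) → ℝ}
    (hsol : IsClassicalNSSolutionOn (Ico 0 T) ν 0 u p) (hLH : IsLerayHopfOn T ν 0 (u 0) u)
    (hdec : HasRapidSpatialDecay (u 0))
    (hnot : ¬ (∃ θ : ℝ, 0 ≤ θ ∧ θ < 1 ∧ ∀ κ : ℝ, (∀ (v : EuclideanSpace ℝ (Fin 3) → EuclideanSpace ℝ (Fin 3)) (M B : ℝ), ContDiff ℝ (⊤ : ℕ∞) v → Literature.Analysis.FluidPDE.VectorCalculus.IsDivFree v → (∀ x, ‖v x‖ ≤ M) → (∀ x, ‖fderiv ℝ v x‖ ≤ B) → (∫⁻ x, ‖iteratedFDeriv ℝ 0 v x‖ₑ ^ 2 < ⊤) → (∫⁻ x, ‖iteratedFDeriv ℝ 1 v x‖ₑ ^ 2 < ⊤) → (∫⁻ x, ‖iteratedFDeriv ℝ 2 v x‖ₑ ^ 2 < ⊤) → |∫ x, ⟪Literature.Analysis.FluidPDE.curl v x, fderiv ℝ v x (Literature.Analysis.FluidPDE.curl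 v x)⟫_ℝ| ≤ κ * M * Real.sqrt (∫ x, ‖Literature.Analysis.FluidPDE.curl v x‖ ^ 2) * Real.sqrt (∫ x, Literature.Analysis.FluidPDE.frobeniusNormSq (fderiv ℝ (Literature.Analysis.FluidPDE.curl v) x))) → ∃ t₁ ∈ Set.Ico 0 T, ∃ (k : ℝ → ℝ) (B : ℝ), Measurable k ∧ (∀ τ, 0 ≤ k τ ∧ k τ ≤ 1) ∧ (∀ t ∈ Set.Ico t₁ T, ∀ M : ℝ, (∀ x, ‖u t x‖ ≤ M) → |∫ x, ⟪Literature.Analysis.FluidPDE.curl (u t) x, fderiv ℝ (u t) x (Literature.Analysis.FluidPDE.curl (u t) x)⟫_ℝ| ≤ k t * M * Real.sqrt (∫ x, ‖Literature.Analysis.FluidPDE.curl (u t) x‖ ^ 2) * Real.sqrt (∫ x, Literature.Analysis.FluidPDE.frobeniusNormSq (fderiv ℝ (Literature.Analysis.FluidPDE.curl (u t)) x))) ∧ (∀ t ∈ Set.Ico t₁ T, ∫ τ in t₁..t, k τ ^ 2 / (T - τ) ≤ (θ * κ) ^ 2 * Real.log ((T - t₁) / (T - t)) + B))) :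
    ∀ m : ℝ, 0 ≤ m → m < sInf {κ : ℝ | (∀ (v : EuclideanSpace ℝ (Fin 3) → EuclideanSpace ℝ (Fin 3)) (M B : ℝ), ContDiff ℝ (⊤ : ℕ∞) v → Literature.Analysis.FluidPDE.VectorCalculus.IsDivFree v → (∀ x, ‖v x‖ ≤ M) → (∀ x, ‖fderiv ℝ v x‖ ≤ B) → (∫⁻ x, ‖iteratedFDeriv ℝ 0 v x‖ₑ ^ 2 < ⊤) → (∫⁻ x, ‖iteratedFDeriv ℝ 1 v x‖ₑ ^ 2 < ⊤) → (∫⁻ x, ‖iteratedFDeriv ℝ 2 v x‖ₑ ^ 2 < ⊤) → |∫ x, ⟪Literature.Analysis.FluidPDE.curl v x, fderiv ℝ v x (Literature.Analysis.FluidPDE.curl v x)⟫_ℝ| ≤ κ * M * Real.sqrt (∫ x, ‖Literature.Analysis.FluidPDE.curl v x‖ ^ 2) * Real.sqrt (∫ x, Literature.Analysis.FluidPDE.frobeniusNormSq (fderiv ℝ (Literature.Analysis.FluidPDE.curl v) x)))} → ∀ t₁ ∈ Set.Ico 0 T,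
      volume {t : ℝ | t ∈ Set.Ico t₁ T ∧ ∃ M : ℝ, (∀ x, ‖u t x‖ ≤ M) ∧ m * M * Real.sqrt (∫ x, ‖Literature.Analysis.FluidPDE.curl (u t) x‖ ^ 2) * Real.sqrt (∫ x, Literature.Analysis.FluidPDE.frobeniusNormSq (fderiv ℝ (Literature.Analysis.FluidPDE.curl (u t)) x)) < |∫ x, ⟪Literature.Analysis.FluidPDE.curl (u t) x, fderiv ℝ (u t) x (Literature.Analysis.FluidPDE.curl (u t) x)⟫_ℝ| ∧ (m * M) ^ 4 ≤ ((SNormLESNormFDerivOfEqConst (EuclideanSpace ℝ (Fin 3)) (volume : Measure (EuclideanSpace ℝ (Fin 3))) 2 : ℝ) ^ 3 + 1) ^ 4 * (∫ x, ‖Literature.Analysis.FluidPDE.curl (u t) x‖ ^ 2) * (∫ x, Literature.Analysis.FluidPDE.frobeniusNormSq (fderiv ℝ (Literature.Analysis.FluidPDE.curl (u t)) x))} ≠ 0 := by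
  intro m hm0 hm t₁ ht₁ hnull
  have hloc := isLocalSolution hν hT hsol hLH hdec
  refine nearEfficient_recurrence_of_not_perFlow hν hT hsol hLH hdec hnot m hm t₁ ht₁ (measure_mono_null ?_ hnull)
  rintro t ⟨ht, M, hM, heff⟩
  have htT : t ∈ Set.Ico 0 T := ⟨ht₁.1.trans ht.1, ht.2⟩
  have hv3 : ContDiff ℝ 3 (u t) := (hsol.contDiff_velocity htT).of_le (by norm_cast)
  have hdiv : VectorCalculus.IsDivFree (u t) := hsol.divFree _ htT
  have h0 : ∫⁻ x, ‖u t x‖ₑ ^ 2 < ⊤ := by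
    have h := sobolev_slice hloc htT 0
    have heq : (fun x => ‖iteratedFDeriv ℝ 0 (u t) x‖ₑ ^ 2) = fun x => ‖u t x‖ₑ ^ 2 := by
      funext x
      rw [← ofReal_norm, ← ofReal_norm, norm_iteratedFDeriv_zero]
    simpa only [heq] using h
  exact ⟨ht, M, hM, heff, zp_lower_of_efficient hv3 hdiv h0 (sobolev_slice hloc htT 1)
    (sobolev_slice hloc htT 2) hm0 hM heff⟩

end Summit.NavierStokesRegularity.NavierStokesRegularity.Theorems.DepletionLadder.PerFlow

end
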